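import Summits.ResolutionOfSingularities.ResolutionOfSingularities.Theorems.PurityCutClasses
import HarnessLib

/-!
# PurityCutClasses2 — decomp-res node «PurityCut» (lens-2 g16 rev 1), file 2/2 of `PurityCutClasses`

Content VERBATIM from the decomp-res lens-2 g16 node `HOME/decomp-res-lens-2/g16/PurityCut.lean` rev 1 (pin c1c78f8a
= `parts/PurityCut-rev1-c1c78f8a.lean`, 2 025 l;
HOME = run/shared/lean/pub/decomp-res; CRITIC-LEDGER row 140 CLEARED; landing orders INBOX :288 (row-140 line: split
/ order / asides) and :296 (land from rev 1:
docstring-only changes + eight ring-identity kernels).  The lens's §R (l. 121–1020: 89 declarations RESTATED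
VERBATIM-IN-BODY from lens-2 g14 `PinchCut` rev 1 and
g15 `JetCut` rev 5) is DELETED — those are the tree's `PinchCutClasses` / `PinchCutKernels` / `JetCut*` modules
(namespaces `…Theorems.PinchCut`, `…Theorems.JetCut`
with its sub-namespace `Vast`, opened; same short names, byte-identical bodies — never two copies).  Namespace
`…Theorems.PurityCut` (the lens's `Theses.PurityCut`
is gate-reserved), sub-namespaces `Leaf` / `Grand` as in the lens; file split only (tree files ≤ 400 lines):
sections, variables and every declaration exactly as in
the lens.  Node files, in import order: `PurityCutLeaf` (§G) · `PurityCutClasses` (§P, continued `…2` / `…3` as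
needed) · `PurityCutGrand` (§H cone-free: the aside
home) · the wiring `MaxContactCutPurityCut` (§G/§H BY NAME on the host route, in the Theses cone).  All `--supports
stmt-ResolutionOfSingularities-29273`
(`MaxContactCut.RungOne`); nothing closes 29273 — decided halves carry their engines as hypotheses; exactly ONE
located-residual aside is booked on the route for
the lens-2 column (`Grand.GrandSpecialRung`, home `PurityCutGrand`), SUPERSEDING the JetCut residual
`Vast.VastSpecialRung` (critic :288: «if Vast is not yet filed,
file Grand only; never both») and re-locating the tree aside 33866 `LeafSpecialRung` EXACTLY modulo the grand decided half.

§P (NEW, g16; rev 1): the PURE LADDER (D⁺) — the `n ∣ k` COMPLETION of g15's degenerate-vertex ladder (D), typed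
UNIFORMLY along the top curve with the LAST-STAGE A-POINT (STRAY) CLAUSE: `StrayClean`, `PureLadderShape`,
`IsPureLadderAt`, `IsUniformPureLadderCurve`, ENGINE (D⁺) `def PureLadderExit : Prop` (EXACT-ON-PAPER, carried as a
hypothesis like the other five engines), `IsPureLadderCurvePt`, the GRAND leaf classes `IsGrandCurvePt` /
`GrandExit` / `IsGrandSpecialPt`, and the ring KERNELS `pure_depth`, `stray_no_gap`, `stray_pair_values`,
`frobenius_exact_three`, `bridge_core` / `unit_presentation`, `bridge_unit_clause_value` + rev 1's eight
ring-identity kernels `pure_translate` / `represent_S5` / `represent_P3` / `represent_P5` / `represent_P7a` /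
`represent_P7b` / `represent_P8` / `root_S5` (PROVED) — VERBATIM; the 95-line §P law prose of rev 0 lives in
HOME/decomp-res-lens-2/g16/NODE-g16.md (archive), the tree keeps the short rev-1 docstrings.

Part 2/2 carries: `BinomGuard`, `StrayClean`, `PureLadderShape`, `strayClean_of_not_guard`,
`not_degLadderShape_of_pureLadderShape`, `not_ladderShape_of_pureLadderShape`, `PureLadderShape.three_le_of_core`,
`PureLadderShape.depth`, `IsPureLadderAt`, `IsUniformPureLadderCurve`, `PureLadderExit`, `IsPureLadderCurvePt`,
`IsGrandCurvePt`, `GrandExit`, `IsGrandSpecialPt`, `isGrandCurvePt_of_isVastCurvePt`,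
`isGrandCurvePt_of_isPureLadderCurvePt`, `isCurveExitPt_of_isPureLadderCurvePt`, `isCurveExitPt_of_isGrandCurvePt`,
`isVastSpecialPt_of_isGrandSpecialPt`, `isPinchSpecialPt_of_isGrandSpecialPt`,
`isLeafSpecialPt_of_isGrandSpecialPt`, `not_isGrandSpecialPt_of_isGrandCurvePt`, `isVastSpecialPt_and_not_isGrandSpecialPt_iff`.

(Sources: Hironaka1964 Ch. III; CossartJannsenSaito2020 Ch. 2, Ch. 8–9; CossartPiltant2008 Prop. 4.2;
CossartPiltant2019 Rem. 3.2; BierstoneGrigorievMilmanWlodarczyk2011 §3.1; Moh1987; Hauser2010Kangaroo; Giraud1975;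
Narasimhan1983; HunekeSwanson2006 Cor. 5.5.5.)
-/

open CategoryTheory AlgebraicGeometry TopologicalSpace IsLocalRing
open Literature.AlgebraicGeometry.Resolution
open Summit.ResolutionOfSingularities.ResolutionOfSingularities.Theorems
open Summit.ResolutionOfSingularities.ResolutionOfSingularities.Theorems.WeakOrderReduction
open Summit.ResolutionOfSingularities.ResolutionOfSingularities.Theorems.DeltaFaceCutClasses
open Summit.ResolutionOfSingularities.ResolutionOfSingularities.Theorems.RelativeDeltaCut
open Summit.ResolutionOfSingularities.ResolutionOfSingularities.Theorems.CurveLeafExit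
open Summit.ResolutionOfSingularities.ResolutionOfSingularities.Theorems.PinchCut
open Summit.ResolutionOfSingularities.ResolutionOfSingularities.Theorems.JetCut

namespace Summit.ResolutionOfSingularities.ResolutionOfSingularities.Theorems.PurityCut

section PureRing

variable {R : Type} [CommRing R]

/-- **THE GUARD** `BinomGuard M n` [g16]: every middle binomial coefficient `C(n, i)`, `0 < i < n`, lies in `M` — in the frame
(`R` an `𝔽_p`-algebra, `M` maximal) exactly: `n` is a power of `p`.  Under the guard `(x − a)ⁿ = xⁿ ± aⁿ` and the last-stage
polynomials `Tⁿ + ε̄`, `1 + β̄Tⁿ` can have a root of multiplicity `n`.  DEFINITION (NEW, elementary). -/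
def BinomGuard (M : Ideal R) (n : ℕ) : Prop :=
  ∀ i : ℕ, 0 < i → i < n → ((n.choose i : ℕ) : R) ∈ M

/-- **THE A-POINT (STRAY) CLAUSE** `StrayClean M c β π ε n m` [g16]: under the guard, the last-stage fibre polynomial
`x₀ⁿ + βx₁ⁿ + π^m ε` takes NO value in `(c) + Mⁿ` on `R²` — i.e. has valuation `≤ n − 1` at every `A`-point, `A = R/(c)`.  Given
`SideClean` this is EXACTLY «every point of the last fibre exits by order» (§P (1b)); automatic for `m ≥ 2`.  DEFINITION (NEW
class predicate). -/
def StrayClean (M : Ideal R) (c : Fin 3 → R) (β π ε : R) (n m : ℕ) : Prop :=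
  BinomGuard M n → ∀ x₀ x₁ : R, x₀ ^ n + β * x₁ ^ n + π ^ m * ε ∉ Ideal.span (Set.range c) ⊔ M ^ n

/-- **PURE LADDER SHAPE** `PureLadderShape M c β π ε h f n m k` [g16; the `n ∣ k` completion of rev 5's `DegLadderShape`]:
`f = c 0 ^ n + β * c 1 ^ n + π ^ m * ε * c 2 ^ k + h`, `ε` a unit, `h ∈ Wt c n k (n*k+1)` (rev 3's ideal VERBATIM), `n ∣ k`,
`n ≤ k`, `1 ≤ m < n`, `π` a transversal parameter (`span (c, π) = M`), the cone coefficient `β = π` (CORE) or a unit, rev 3's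
side condition, `3 ≤ n` at a core, and the A-point clause `StrayClean`.  EXACT-ON-PAPER consequence (§P docstring): principal
`I = (f)` of this shape uniformly along the regular top curve `V(c)` EXITS BY ORDER after `k/n` blow-ups of section curves.
DEFINITION (NEW class predicate). [folklore; CossartJannsenSaito2020 Ch. 2] -/
def PureLadderShape (M : Ideal R) (c : Fin 3 → R) (β π ε h f : R) (n m k : ℕ) : Prop :=
  f = c 0 ^ n + β * c 1 ^ n + π ^ m * ε * c 2 ^ k + h ∧ IsUnit ε ∧ h ∈ WtIdeal c n k (n * k + 1) ∧ n ∣ k ∧ n ≤ k ∧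
    1 ≤ m ∧ m < n ∧ Ideal.span (Set.range c ∪ {π}) = M ∧ (β = π ∨ IsUnit β) ∧ SideClean M c β n ∧ (β = π → 3 ≤ n) ∧
    StrayClean M c β π ε n m

/-- When some middle binomial is a unit (e.g. `p ∤ n`) the guard fails and the clause is void.  KERNEL (PROVED). [folklore] -/
theorem strayClean_of_not_guard {M : Ideal R} (c : Fin 3 → R) (β π ε : R) {n : ℕ} (m : ℕ) (hM : M ≠ ⊤) {i : ℕ}
    (hi : 0 < i) (hin : i < n) (hu : IsUnit (((n.choose i : ℕ) : R))) : StrayClean M c β π ε n m :=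
  fun hG => absurd (Ideal.eq_top_of_isUnit_mem M (hG i hi hin) hu) hM

/-- **(D⁺) and (D) are DISJOINT BY LETTER in a given presentation**: `n ∣ k` vs `n ∤ k`.  KERNEL (PROVED). [folklore] -/
theorem not_degLadderShape_of_pureLadderShape {M : Ideal R} {c : Fin 3 → R} {β π ε ε' h h' f : R} {n m m' k : ℕ}
    (hP : PureLadderShape M c β π ε h f n m k) : ¬ DegLadderShape M c β ε' h' f n m' k :=
  fun hD => hD.2.2.2.2.1 hP.2.2.2.1

/-- … and disjoint from rev 3's (L) in the same exponent.  KERNEL (PROVED). [folklore] -/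
theorem not_ladderShape_of_pureLadderShape {M : Ideal R} {c : Fin 3 → R} {β π ε ε' h h' f : R} {n m k : ℕ}
    (hP : PureLadderShape M c β π ε h f n m k) : ¬ LadderShape M c β ε' h' f n k :=
  fun hL => hL.2.2.2.2.1 hP.2.2.2.1

/-- Projections used by the law: the core needs `n ≥ 3`; the depth data.  KERNEL (PROVED). [folklore] -/
theorem PureLadderShape.three_le_of_core {M : Ideal R} {c : Fin 3 → R} {π ε h f : R} {n m k : ℕ}
    (hP : PureLadderShape M c π π ε h f n m k) : 3 ≤ n :=
  hP.2.2.2.2.2.2.2.2.2.2.1 rfl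

/-- `PureLadderShape.depth`: Auxiliary step of this node's calculus, VERBATIM from the lens file (see the module
docstring); the statement is its type. [folklore] -/
theorem PureLadderShape.depth {M : Ideal R} {c : Fin 3 → R} {β π ε h f : R} {n m k : ℕ}
    (hP : PureLadderShape M c β π ε h f n m k) :
    (∀ i, i < k / n → n ≤ k - i * n) ∧ k - (k / n) * n = 0 ∧ 1 ≤ k / n ∧ k % n = 0 :=
  pure_depth (by have := hP.2.2.2.2.2.1; have := hP.2.2.2.2.2.2.1; omega) hP.2.2.2.1 hP.2.2.2.2.1

end PureRing

/-! ### §P2  point level — pure ladder points, uniformly shaped curves (`m` per point), ENGINE (D⁺), the GRAND leaf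
and its residual -/

/-- **PURE-LADDER-SHAPED at `y` transversal to `η` with exponents `(n, k)`** [g16] (`IsPureLadderAt I n k η y`):
germ dimension 4,
regular parameters `c = (z, U, W)` generating the curve prime, a transversal parameter `π`, `I_y = (f)` PRINCIPAL, `f` of pure
ladder shape for SOME `m` (existential per point).  DEFINITION (NEW class predicate). (Sources:
CossartJannsenSaito2020 Ch. 2; folklore.) -/
def IsPureLadderAt {Y : Scheme.{0}} (I : Y.IdealSheafData) (n k : ℕ) (η y : Y) : Prop :=
  ∃ h : η ⤳ y, ∃ (c : Fin 3 → Y.presheaf.stalk y) (π β ε r f : Y.presheaf.stalk y) (m : ℕ),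
    Ideal.span (Set.range c) = curvePrime h ∧
      (maximalIdeal (Y.presheaf.stalk y)).spanFinrank = 4 ∧
      stalkIdeal I y = Ideal.span {f} ∧
      PureLadderShape (maximalIdeal (Y.presheaf.stalk y)) c β π ε r f n m k

/-- **UNIFORMLY PURE-LADDER-SHAPED CURVE** [g16] (`IsUniformPureLadderCurve I n k η`): `η` is a curve point and
EVERY closed point
of `closure {η}` is pure-ladder-shaped transversal to `η` with the SAME `(n, k)` (`m`, `β`, `π`, `ε` vary with the point).  The
hypothesis of ENGINE (D⁺).  DEFINITION (NEW class predicate). -/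
def IsUniformPureLadderCurve {Y : Scheme.{0}} (I : Y.IdealSheafData) (n k : ℕ) (η : Y) : Prop :=
  IsCurvePt η ∧ ∀ y : Y, η ⤳ y → IsClosed ({y} : Set Y) → IsPureLadderAt I n k η y

/-- **ENGINE (D⁺) `PureLadderExit`** [g16; DECIDED · paper proof = the §P docstring: `k/n` blow-ups of section curves (shape
reproduction `ladder_chart_identity` / `ladder_monomial_identity` / `ladder_weight_step`, depth `pure_depth`,
KERNEL), last stage
`pure_last_identity` + `wtIdeal_zero_le_span` (KERNEL), exits by ORDER at the section point (`m < n`), on the line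
`w = 0` and the
side curve (`SideClean`), and at the STRAY points (stray lemma `ord ≤ μ + 1`, gap lemma `stray_no_gap` (KERNEL), Frobenius
exactness under the guard, the A-point clause `StrayClean`); ingredients of the port: HS 5.5.5, permissibility of
regular centres in
the top locus of a principal marked ideal, semicontinuity of order, density of closed points, Hasse-derivative
multiplicity — every
characteristic and residue field of the frame]: a uniformly pure-ladder-shaped curve of order `n ≥ 2` has an exit package with
centres over it.  STATEMENT (engine). (Sources: Hironaka1964; CossartJannsenSaito2020 Ch. 2, Ch. 8;
CossartPiltant2008 Prop. 4.2.) -/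
def PureLadderExit : Prop :=
  ∀ (Y : Scheme.{0}), Scheme.IsRegular Y → ∀ (I : Y.IdealSheafData) (n : ℕ), 2 ≤ n → ∀ (k : ℕ) (η : Y),
    IsUniformPureLadderCurve I n k η → PackageExitsOver I n {y : Y | η ⤳ y}

/-- **PURE-LADDER-CURVE point** [g16] (NEW DECIDED CLASS, leaf (D⁺)): `y` lies on (or is the generic point of) a Top-isolated,
uniformly pure-ladder-shaped curve.  Inhabitant: the core of the bridge bed `g` (§P BED).  DEFINITION (NEW class). -/
def IsPureLadderCurvePt {Y : Scheme.{0}} (I : Y.IdealSheafData) (n : ℕ) (y : Y) : Prop :=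
  ∃ (η : Y) (k : ℕ), η ⤳ y ∧ IsTopIsolatedClosure I n η ∧ IsUniformPureLadderCurve I n k η

/-- **GRAND-CURVE point** [g16] (leaf (G) = (V) ∪ (D⁺)): vast-curve OR pure-ladder-curve.  DEFINITION (NEW class). -/
def IsGrandCurvePt {Y : Scheme.{0}} (I : Y.IdealSheafData) (n : ℕ) (y : Y) : Prop :=
  IsVastCurvePt I n y ∨ IsPureLadderCurvePt I n y

/-- The two engines of the grand leaf bundled: (V) ∧ (D⁺).  STATEMENT (conjunction of engines). -/
def GrandExit : Prop :=
  VastExit ∧ PureLadderExit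

/-- **GRAND-SPECIAL point** [g16] — THE LOCATED RESIDUAL CLASS of this node: pinch-special (g14) and NOT a
grand-curve point, i.e.
vast-special (g15 rev 5) and not a pure-ladder-curve point.  What is LEFT: principal tails whose lowest face has a
CANCELLING EDGE
FORM (binary towers, critic class (ii)), NON-PRINCIPAL `I_y` (iii), the DEEP-COEFFICIENT germs of the binomial-cone family (a
MAXIMAL presentation with `n ∣ k` and leader valuation `m ≥ n`; [rev 1] NOT the census rows P3 P5 P7a P7b P8 S5,
which re-present
into (L)/(D) by `pure_translate` / `represent_*`), curves failing uniformity or Top-isolation, and the Sing / Tangle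
/ Iso columns (iv) (bed: `u₁⁵ + u₂⁵`-type symmetric
tails under a cone, `HauserE7`, `Narasimhan`, the three binary towers; NOT the bridge bed `g`, NOT `deeptail`, NOT `branch:2`).
DEFINITION (NEW class). [folklore] -/
def IsGrandSpecialPt {k : Type} [Field k] {Y : Scheme.{0}} (g : Y ⟶ Spec (.of k)) (hY : Scheme.IsRegular Y)
    (I : Y.IdealSheafData) (n : ℕ) (y : Y) : Prop :=
  IsPinchSpecialPt g hY I n y ∧ ¬ IsGrandCurvePt I n y

/-- (V) ⊆ (G).  KERNEL (PROVED). [folklore] -/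
theorem isGrandCurvePt_of_isVastCurvePt {Y : Scheme.{0}} {I : Y.IdealSheafData} {n : ℕ} {y : Y} :
    IsVastCurvePt I n y → IsGrandCurvePt I n y :=
  Or.inl

/-- (D⁺) ⊆ (G).  KERNEL (PROVED). [folklore] -/
theorem isGrandCurvePt_of_isPureLadderCurvePt {Y : Scheme.{0}} {I : Y.IdealSheafData} {n : ℕ} {y : Y} :
    IsPureLadderCurvePt I n y → IsGrandCurvePt I n y :=
  Or.inr

/-- Under ENGINE (D⁺), every pure-ladder-curve point is a curve-exit point of g12's port.  KERNEL (PROVED). [folklore] -/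
theorem isCurveExitPt_of_isPureLadderCurvePt {Y : Scheme.{0}} {I : Y.IdealSheafData} {n : ℕ} {y : Y}
    (hP : PureLadderExit) (hY : Scheme.IsRegular Y) (hn : 2 ≤ n) (h : IsPureLadderCurvePt I n y) :
    IsCurveExitPt I n y := by
  obtain ⟨η, k, hηy, hiso, hcurve⟩ := h
  exact ⟨η, hηy, hcurve.1, hiso, hP Y hY I n hn k η hcurve⟩

/-- Under ENGINE (G) = (V) ∧ (D⁺), every grand-curve point is a curve-exit point.  KERNEL (PROVED). [folklore] -/
theorem isCurveExitPt_of_isGrandCurvePt {Y : Scheme.{0}} {I : Y.IdealSheafData} {n : ℕ} {y : Y}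
    (hG : GrandExit) (hY : Scheme.IsRegular Y) (hn : 2 ≤ n) (h : IsGrandCurvePt I n y) :
    IsCurveExitPt I n y := by
  rcases h with h | h
  · exact isCurveExitPt_of_isVastCurvePt hG.1 hY hn h
  · exact isCurveExitPt_of_isPureLadderCurvePt hG.2 hY hn h

/-- Grand-special ⇒ vast-special ⇒ … ⇒ pinch-special ⇒ leaf-special (the located class keeps shrinking).  KERNEL
(PROVED). [folklore] -/
theorem isVastSpecialPt_of_isGrandSpecialPt {k : Type} [Field k] {Y : Scheme.{0}} {g : Y ⟶ Spec (.of k)}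
    {hY : Scheme.IsRegular Y} {I : Y.IdealSheafData} {n : ℕ} {y : Y} (h : IsGrandSpecialPt g hY I n y) :
    IsVastSpecialPt g hY I n y :=
  ⟨h.1, fun hV => h.2 (Or.inl hV)⟩

/-- `isPinchSpecialPt_of_isGrandSpecialPt`: Auxiliary step of this node's calculus, VERBATIM from the lens file (see
the module docstring); the statement is its type. [folklore] -/
theorem isPinchSpecialPt_of_isGrandSpecialPt {k : Type} [Field k] {Y : Scheme.{0}} {g : Y ⟶ Spec (.of k)}
    {hY : Scheme.IsRegular Y} {I : Y.IdealSheafData} {n : ℕ} {y : Y} (h : IsGrandSpecialPt g hY I n y) :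
    IsPinchSpecialPt g hY I n y :=
  h.1

/-- `isLeafSpecialPt_of_isGrandSpecialPt`: Auxiliary step of this node's calculus, VERBATIM from the lens file (see
the module docstring); the statement is its type. [folklore] -/
theorem isLeafSpecialPt_of_isGrandSpecialPt {k : Type} [Field k] {Y : Scheme.{0}} {g : Y ⟶ Spec (.of k)}
    {hY : Scheme.IsRegular Y} {I : Y.IdealSheafData} {n : ℕ} {y : Y} (h : IsGrandSpecialPt g hY I n y) :
    IsLeafSpecialPt g hY I n y :=
  h.1.1

/-- A grand-curve point is never grand-special; in particular the bridge bed `g` (a pure-ladder-curve point at its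
core by §P) has
LEFT the located class.  KERNEL (PROVED). [folklore] -/
theorem not_isGrandSpecialPt_of_isGrandCurvePt {k : Type} [Field k] {Y : Scheme.{0}} {g : Y ⟶ Spec (.of k)}
    {hY : Scheme.IsRegular Y} {I : Y.IdealSheafData} {n : ℕ} {y : Y} (h : IsGrandCurvePt I n y) :
    ¬ IsGrandSpecialPt g hY I n y :=
  fun hs => hs.2 h

/-- Vast-special and not grand-special ⟺ vast-special and pure-ladder-curve: WHAT LEFT THE RESIDUAL is exactly the new leaf (D⁺)
inside the old residual.  KERNEL (PROVED). [folklore] -/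
theorem isVastSpecialPt_and_not_isGrandSpecialPt_iff {k : Type} [Field k] {Y : Scheme.{0}} {g : Y ⟶ Spec (.of k)}
    {hY : Scheme.IsRegular Y} {I : Y.IdealSheafData} {n : ℕ} {y : Y} :
    (IsVastSpecialPt g hY I n y ∧ ¬ IsGrandSpecialPt g hY I n y) ↔
      (IsVastSpecialPt g hY I n y ∧ IsPureLadderCurvePt I n y) := by
  constructor
  · rintro ⟨hV, hG⟩
    refine ⟨hV, ?_⟩
    by_contra hP
    exact hG ⟨hV.1, fun hGC => hGC.elim hV.2 hP⟩
  · rintro ⟨hV, hP⟩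
    exact ⟨hV, fun hG => hG.2 (Or.inr hP)⟩

end Summit.ResolutionOfSingularities.ResolutionOfSingularities.Theorems.PurityCut
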